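import Literature.NumberTheory.Automorphic.WhittakerHeredityGL
import Literature.NumberTheory.Automorphic.LeviWhittakerLower
import Literature.NumberTheory.Automorphic.FiniteTensorDecomposition
import Literature.NumberTheory.Automorphic.RestrictedTensorCoinvariantBound
import Literature.NumberTheory.Automorphic.WhittakerModelsGelfandKazhdanPairs
import Literature.NumberTheory.Automorphic.LeviDetOneIndex
import Literature.NumberTheory.Automorphic.PAdicRepsJacquetAdmissibilityProofs
import HarnessLib

/-!
# Local multiplicity one for `GL_n(F)`: reduction to supercuspidal representations, and to the
Gelfand–Kazhdan lemma

Topic `NumberTheory/Automorphic`; the assembly file of the Bernstein–Zelevinsky route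
(1977, §4.7) to the named fact
`Literature.NumberTheory.Automorphic.rank_whittakerFunctionals_le_one` (uniqueness of Whittaker
functionals for irreducible smooth representations of `GL_n(F)`).

* `rank_leviWhittakerFunctionals_le_one` — **the top derivative of a cuspidal datum is a line**:
  for an irreducible smooth supercuspidal representation `σ` of the standard Levi
  `M = Π_a GL(B_a, F)` the space of Levi Whittaker functionals of the inducing datum
  `σ ∘ proj ⊗ δ^{1/2}` (`WhittakerHeredityGL.leviWhittakerFunctionals`) has rank `≤ 1`, *provided*
  irreducible smooth supercuspidal representations of the `GL_{n_a}(F)` have multiplicity one.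
  Proof (Bernstein–Zelevinsky 1977, §4.7, "`(ρ₁ × … × ρ_r)^{(n)} = ρ₁^{(n₁)} ⊗ … ⊗ ρ_r^{(n_r)}`,
  each one-dimensional"): the Levi relation holds block by block (`LeviWhittakerLower`), so these
  functionals kill the span `M_θ` of the `σ(ι_a(ẽ_a u ẽ_a⁻¹)) w - ψ_{U_{n_a}}(u) w`; `σ` is
  admissible (Harish-Chandra), hence a tensor product `⊗_a ρ_a` of irreducible admissible
  representations of the blocks (Flath, `FiniteTensorDecomposition`), which are supercuspidal
  (`isSupercuspidal_factor`); in the coordinates `ẽ_a` each `ρ_a` is an irreducible smooth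
  supercuspidal representation of `GL_{n_a}(F)` whose twisted Jacquet module `J_ψ(ρ_a)` has rank
  `≤ 1` (hypothesis + `rank_whittakerFunctionals_le_one_iff`), and the slot-by-slot bound
  (`RestrictedTensorCoinvariantBound`) gives `rank (W / M_θ) ≤ 1`, whence the dual bound.
* `rank_whittakerFunctionals_le_one_of_supercuspidal` — **local multiplicity one for all
  irreducible smooth representations of `GL_n(F)` follows from the supercuspidal case for
  `GL_m(F)`, `2 ≤ m ≤ n`** (Bernstein–Zelevinsky 1977, §4.7 with Thm. 4.4): combine with the heredity
  reduction `rank_whittakerFunctionals_le_one_of_levi` (`WhittakerHeredityGL`: cuspidal support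
  `π ↪ i_c σ`, exactness of `r_{U,θ}`, Bruhat filtration of `i_c σ|_{U_n}`).
* `rank_whittakerFunctionals_le_one_of_gelfandKazhdanA` — consequently the named fact for `GL_n(F)`
  follows from the **Gelfand–Kazhdan lemma alone** (Bump 1997, Thm. 4.4.2: bi-`ψ_U`-quasi-invariant
  distributions on `GL_m(F)` are stable under `g ↦ w⁰ ᵗg w⁰`), for `2 ≤ m ≤ n` and the characters
  `ψ, ψ⁻¹`, via `rank_whittakerFunctionals_le_one_of_isSupercuspidal_of_gelfandKazhdan`
  (`WhittakerModelsGelfandKazhdanPairs`). Gelfand–Kazhdan's Theorem B (`π̃ ≅ π^ι`) is not needed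
  on this route.

One definition with body (`leviWhittakerKer`, the span `M_θ`); theorems otherwise; no named fact.

## References

* I. N. Bernstein, A. V. Zelevinsky, *Induced representations of reductive `p`-adic groups I*,
  Ann. Sci. ÉNS 10 (1977), Thm. 4.4, Lemma 4.5, Cor. 4.6, §4.7. [BernsteinZelevinskyASENS1977]
* I. M. Gelfand, D. A. Kazhdan, *Representations of the group `GL(n, K)` where `K` is a local
  field*, in: Lie groups and their representations (Budapest 1971), Halsted 1975. [GelfandKazhdan1975]
* D. Bump, *Automorphic forms and representations* (1997), Thm. 4.4.1–4.4.2. [Bump1997]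
-/

noncomputable section

open Matrix

namespace Literature.NumberTheory.Automorphic

universe u

/-! ### The span `M_θ` and the Levi Whittaker functionals -/

section LeviKer

variable {F : Type*} [Field F] [ValuativeRel F] [TopologicalSpace F] [IsNonarchimedeanLocalField F]
  {n r : ℕ} (c : Fin n → Fin r) (ψ : AddChar F Circle)
  {W : Type*} [AddCommGroup W] [Module ℂ W] (σ : Representation ℂ (Π a, GL {i // c i = a} F) W)

/-- The span `M_θ ≤ W` of the vectors `σ(ι_a(ẽ_a u ẽ_a⁻¹)) w - ψ_{U_{n_a}}(u) w` (`a` a block,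
`u ∈ U_{n_a}(F)`, `ẽ_a` the decreasing enumeration of the block `B_a`): the kernel of the
projection of `W` onto its `(U_M, θ)`-coinvariants, `U_M = Π_a U_a⁻` in the coordinates `ẽ_a`.
(Bernstein–Zelevinsky 1977, §1.8 (b), §4.7.) [cite: BernsteinZelevinskyASENS1977, §1.8 (b)] -/
def leviWhittakerKer : Submodule ℂ W :=
  Submodule.span ℂ (Set.range fun p :
    (Σ a : Fin r, ↥(upperUnitriangular (Fin (Fintype.card {i // c i = a})) F)) × W =>
      σ (Pi.mulSingle p.1.1 (reindexGL (k := F) (blockEnumRev c p.1.1) (p.1.2 : GL _ F))) p.2 -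
        whittakerCharFun ψ p.1.2 • p.2)

omit [ValuativeRel F] [TopologicalSpace F] [IsNonarchimedeanLocalField F] in
/-- The generators lie in `M_θ`. [folklore] -/
lemma sub_smul_mem_leviWhittakerKer (a : Fin r)
    (u : ↥(upperUnitriangular (Fin (Fintype.card {i // c i = a})) F)) (w : W) :
    σ (Pi.mulSingle a (reindexGL (k := F) (blockEnumRev c a) (u : GL _ F))) w - whittakerCharFun ψ u • w ∈
      leviWhittakerKer c ψ σ :=
  Submodule.subset_span ⟨(⟨a, u⟩, w), rfl⟩

/-- **The Levi Whittaker functionals of the inducing datum kill `M_θ`** (the Levi relation block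
by block, `apply_mulSingle_reindexGL_of_cell_relation`). [folklore] -/
theorem leviWhittakerFunctionals_le_dualAnnihilator (hc : Monotone c) :
    leviWhittakerFunctionals c
        (Representation.twist (σ.comp (leviProjection F c)) (rootDeltaChar (standardParabolicGL F c))) ψ ≤
      (leviWhittakerKer c ψ σ).dualAnnihilator := by
  intro l hl
  rw [Submodule.mem_dualAnnihilator]
  have hgen : ∀ (a : Fin r) (u : ↥(upperUnitriangular (Fin (Fintype.card {i // c i = a})) F)) (w : W),
      l (σ (Pi.mulSingle a (reindexGL (k := F) (blockEnumRev c a) (u : GL _ F))) w) = whittakerCharFun ψ u * l w :=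
    apply_mulSingle_reindexGL_of_cell_relation c σ ψ hc l
      ((mem_leviWhittakerFunctionals_iff c _ ψ l).1 hl)
  have hle : leviWhittakerKer c ψ σ ≤ LinearMap.ker l := by
    rw [leviWhittakerKer, Submodule.span_le]
    rintro _ ⟨⟨⟨a, u⟩, w⟩, rfl⟩
    rw [SetLike.mem_coe, LinearMap.mem_ker, map_sub, map_smul, hgen, smul_eq_mul, sub_self]
  intro w hw
  exact hle hw

end LeviKer

/-! ### The rank bound for a cuspidal datum -/

section LeviBound

variable {F : Type u} [Field F] [ValuativeRel F] [TopologicalSpace F] [IsNonarchimedeanLocalField F]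
  {n r : ℕ} (c : Fin n → Fin r) (ψ : AddChar F Circle)
  {W : Type u} [AddCommGroup W] [Module ℂ W] (σ : Representation ℂ (Π a, GL {i // c i = a} F) W)

/-- **`rank (W / M_θ) ≤ 1` for an irreducible supercuspidal `σ`**, granted multiplicity one for the
irreducible smooth supercuspidal representations of the `GL_{n_a}(F)` (Bernstein–Zelevinsky 1977,
§4.7: `σ ≅ ⊗ ρ_a` by Flath's theorem, the `ρ_a` are supercuspidal, and
`(⊗ ρ_a)_{U_M,θ}` is spanned by the image of `⊗ e_a` when each `(ρ_a)_{U_a,θ_a}` is spanned by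
`ē_a`). [cite: BernsteinZelevinskyASENS1977, §4.7] -/
theorem rank_quotient_leviWhittakerKer_le_one [σ.IsIrreducible] (hσ : σ.IsSmooth) (hsc : σ.IsSupercuspidal)
    (hGL : ∀ (a : Fin r) (V : Type u) [AddCommGroup V] [Module ℂ V]
      (ρ : Representation ℂ (GL (Fin (Fintype.card {i // c i = a})) F) V),
      ρ.IsIrreducible → ρ.IsSmooth → ρ.IsSupercuspidal → Module.rank ℂ ↥(whittakerFunctionals ρ ψ) ≤ 1) :
    Module.rank ℂ (W ⧸ leviWhittakerKer c ψ σ) ≤ 1 := by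
  classical
  haveI : ∀ a, NonarchimedeanGroup (GL {i // c i = a} F) := fun a => nonarchimedeanGroup_block F c a
  haveI : ∀ a, LocallyCompactSpace (GL {i // c i = a} F) := fun a => locallyCompactSpace_gl' F _
  haveI : SigmaCompactSpace (Π a, GL {i // c i = a} F) := sigmaCompactSpace_levi F c
  haveI : Nontrivial W := Representation.IsIrreducible.nontrivial σ
  -- compact open subgroups of the blocks and admissibility of `σ`
  choose K hKo hKc using fun a => Representation.exists_isOpen_isCompact_subgroup (G := GL {i // c i = a} F)
  have hadm : σ.IsAdmissible := Representation.IsSupercuspidal.isAdmissible_of_sigmaCompactSpace hσ hsc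
  -- Flath: `σ ≅ ⊗ ρ_a`
  obtain ⟨V, _, _, ρ, x₀, j, hj, hspan, hequiv, hρ⟩ := exists_tensorDecomposition (K := K) hKo hKc σ hadm
  have hρs : ∀ a, (ρ a).IsSmooth := fun a => (hρ a).2.isSmooth
  -- the factors in the coordinates `ẽ_a`
  have hfac : ∀ a, ∃ e : V a, ∀ v : V a, ∃ t : ℂ,
      v - t • e ∈ Representation.Coinvariants.ker
        (whittakerTwist ((ρ a).comp (reindexGL (k := F) (blockEnumRev c a)).toMonoidHom) ψ) := by
    intro a
    haveI : (ρ a).IsIrreducible := (hρ a).1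
    set ρ' : Representation ℂ (GL (Fin (Fintype.card {i // c i = a})) F) (V a) :=
      (ρ a).comp (reindexGL (k := F) (blockEnumRev c a)).toMonoidHom with hρ'
    haveI : ρ'.IsIrreducible :=
      isIrreducible_comp_of_surjective (ρ a) _ (reindexGL (k := F) (blockEnumRev c a)).surjective
    have h1 : ρ'.IsSmooth := IsSmooth.comp_of_continuous (ρ a) _ (continuous_reindexGL _) (hρs a)
    have h2 : ρ'.IsSupercuspidal :=
      (isSupercuspidal_factor hKo hKc hσ hsc hj hspan hequiv hρs a).comp_mulEquiv _ (isOpenMap_reindexGL _)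
    have h3 : Module.rank ℂ (twistedJacquet ρ' ψ) ≤ 1 :=
      (rank_whittakerFunctionals_le_one_iff ψ ρ').1 (hGL a (V a) ρ' inferInstance h1 h2)
    rw [rank_le_one_iff] at h3
    obtain ⟨q₀, hq₀⟩ := h3
    obtain ⟨e, rfl⟩ := Representation.Coinvariants.mk_surjective _ q₀
    refine ⟨e, fun v => ?_⟩
    obtain ⟨t, ht⟩ := hq₀ (Representation.Coinvariants.mk _ v)
    refine ⟨t, (Representation.Coinvariants.mk_eq_iff _).1 ?_⟩
    rw [map_smul]
    exact ht.symm
  choose e he using hfac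
  -- the slot-by-slot bound
  refine rank_quotient_le_one_of_span_range_eq_top hj
    (fun a => Representation.Coinvariants.ker
      (whittakerTwist ((ρ a).comp (reindexGL (k := F) (blockEnumRev c a)).toMonoidHom) ψ))
    (leviWhittakerKer c ψ σ) (fun x a => ?_) e he hspan
  rw [ker_whittakerTwist_eq_span, Submodule.span_le]
  rintro _ ⟨⟨u, y⟩, rfl⟩
  rw [SetLike.mem_coe, Submodule.mem_comap]
  dsimp only
  rw [map_sub, map_smul, IsRestrictedMultilinear.slot_apply, IsRestrictedMultilinear.slot_apply,
    MonoidHom.comp_apply, MulEquiv.coe_toMonoidHom, ← RestrictedFamily.piSmul_mulSingle_update ρ, hequiv]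
  exact sub_smul_mem_leviWhittakerKer c ψ σ a u _

/-- **The Levi Whittaker functionals of a cuspidal datum form a space of rank `≤ 1`**, granted
multiplicity one for irreducible smooth supercuspidal representations of the `GL_{n_a}(F)`: they
embed in the dual of `W / M_θ`, of rank `≤ 1`. (Bernstein–Zelevinsky 1977, Thm. 4.4 (b) with
Cor. 4.6 / §4.7: `(ρ₁ × … × ρ_r)^{(n)}` is one-dimensional.) [cite: BernsteinZelevinskyASENS1977, §4.7] -/
theorem rank_leviWhittakerFunctionals_le_one (hc : Monotone c) [σ.IsIrreducible] (hσ : σ.IsSmooth)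
    (hsc : σ.IsSupercuspidal)
    (hGL : ∀ (a : Fin r) (V : Type u) [AddCommGroup V] [Module ℂ V]
      (ρ : Representation ℂ (GL (Fin (Fintype.card {i // c i = a})) F) V),
      ρ.IsIrreducible → ρ.IsSmooth → ρ.IsSupercuspidal → Module.rank ℂ ↥(whittakerFunctionals ρ ψ) ≤ 1) :
    Module.rank ℂ ↥(leviWhittakerFunctionals c
      (Representation.twist (σ.comp (leviProjection F c)) (rootDeltaChar (standardParabolicGL F c))) ψ) ≤ 1 := by
  refine (Submodule.rank_mono (leviWhittakerFunctionals_le_dualAnnihilator c ψ σ hc)).trans ?_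
  rw [← (leviWhittakerKer c ψ σ).dualQuotEquivDualAnnihilator.rank_eq, rank_dual_le_one_iff]
  exact rank_quotient_leviWhittakerKer_le_one c ψ σ hσ hsc hGL

end LeviBound

/-! ### Local multiplicity one from the supercuspidal case and from the Gelfand–Kazhdan lemma -/

section Reduction

variable {F : Type u} [Field F] [ValuativeRel F] [TopologicalSpace F] [IsNonarchimedeanLocalField F]
  {n : ℕ} {V : Type*} [AddCommGroup V] [Module ℂ V]
  (π : Representation ℂ (GL (Fin n) F) V) (ψ : AddChar F Circle)

/-- **Local multiplicity one for `GL_n(F)` from the supercuspidal case** (Bernstein–Zelevinsky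
1977, §4.7 with Thm. 4.4; Gelfand–Kazhdan 1975): if for every `2 ≤ m ≤ n` every irreducible smooth
supercuspidal representation of `GL_m(F)` (on a space in the universe of `F`) has a space of
`ψ`-Whittaker functionals of rank `≤ 1` (for the non-trivial continuous `ψ` at hand; for `m ≤ 1`
this holds outright, `rank_whittakerFunctionals_le_one_of_le_one`), then
`dim Hom_{U_n}(π, ψ_U) ≤ 1` for every irreducible smooth representation `π` of `GL_n(F)` — the
named fact `rank_whittakerFunctionals_le_one π ψ`. (Cuspidal support `π ↪ i_c σ`, exactness of
`r_{U,θ}` and heredity: `rank_whittakerFunctionals_le_one_of_levi`; the cuspidal datum: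
`rank_leviWhittakerFunctionals_le_one`.) [cite: BernsteinZelevinskyASENS1977, §4.7] -/
theorem rank_whittakerFunctionals_le_one_of_supercuspidal
    (h : ψ.IsContinuousNontrivial → ∀ m : ℕ, 2 ≤ m → m ≤ n → ∀ (V' : Type u) [AddCommGroup V'] [Module ℂ V']
      (ρ : Representation ℂ (GL (Fin m) F) V'),
      ρ.IsIrreducible → ρ.IsSmooth → ρ.IsSupercuspidal → Module.rank ℂ ↥(whittakerFunctionals ρ ψ) ≤ 1) :
    rank_whittakerFunctionals_le_one π ψ :=
  rank_whittakerFunctionals_le_one_of_levi π ψ fun hψ r c hc _ W _ _ σ hirr hσ hsc => by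
    haveI := hirr
    refine rank_leviWhittakerFunctionals_le_one c ψ σ hc hσ hsc fun a V' _ _ ρ h1 h2 h3 => ?_
    haveI := h1
    by_cases hm : Fintype.card {i // c i = a} ≤ 1
    · -- blocks of size `≤ 1`: multiplicity one holds outright
      exact rank_whittakerFunctionals_le_one_of_le_one ρ ψ hm h2 hψ
    · exact h hψ _ (by omega) ((Fintype.card_subtype_le _).trans_eq (Fintype.card_fin n)) V' ρ h1 h2 h3

/-- **Local multiplicity one for `GL_n(F)` from the Gelfand–Kazhdan lemma.** Hypothesis `hA m χ`:
Bump's Theorem 4.4.2 for `GL_m(F)` and the character `χ` — every distribution `Δ` on `GL_m(F)`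
with `Δ(λ(u) φ) = χ_U(u) Δ(φ)` and `Δ(ρ(u) φ) = χ_U(u)⁻¹ Δ(φ)` (`u ∈ U_m`) is stable under
`ι(g) = w⁰ ᵗg w⁰` (Gelfand–Kazhdan 1975; Bernstein–Zelevinsky 1976, Thm. 5.17). If it holds for all
`2 ≤ m ≤ n` and `χ ∈ {ψ, ψ⁻¹}`, then every irreducible smooth representation of `GL_n(F)` has a space of
`ψ`-Whittaker functionals of rank `≤ 1`: by
`rank_whittakerFunctionals_le_one_of_isSupercuspidal_of_gelfandKazhdan`
(`WhittakerModelsGelfandKazhdanPairs`) the supercuspidal representations of the `GL_m(F)` then have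
multiplicity one, and `rank_whittakerFunctionals_le_one_of_supercuspidal` applies. On this route
(Bernstein–Zelevinsky 1977, §4.7) Gelfand–Kazhdan's Theorem B is not used.
[cite: GelfandKazhdan1975, §2] [cite: BernsteinZelevinskyASENS1977, §4.7]
[cite: Bump1997, Theorem 4.4.1–4.4.2] -/
theorem rank_whittakerFunctionals_le_one_of_gelfandKazhdanA
    (hA : ∀ m : ℕ, 2 ≤ m → m ≤ n → ∀ χ : AddChar F Circle, (χ = ψ ∨ χ = ψ⁻¹) →
      ∀ Δ : Module.Dual ℂ (SchwartzBruhat (GL (Fin m) F)),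
        (∀ (u : ↥(upperUnitriangular (Fin m) F)) (φ : SchwartzBruhat (GL (Fin m) F)),
          Δ (SchwartzBruhat.leftTranslate (u : GL (Fin m) F) φ) = whittakerCharFun χ u * Δ φ) →
        (∀ (u : ↥(upperUnitriangular (Fin m) F)) (φ : SchwartzBruhat (GL (Fin m) F)),
          Δ (SchwartzBruhat.rightTranslate (u : GL (Fin m) F) φ) = (whittakerCharFun χ u)⁻¹ * Δ φ) →
        ∀ φ, Δ (SchwartzBruhat.compGKInvolution φ) = Δ φ) :
    rank_whittakerFunctionals_le_one π ψ :=
  rank_whittakerFunctionals_le_one_of_supercuspidal π ψ fun hψ m hm2 hm V' _ _ ρ h1 h2 h3 => by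
    haveI := h1
    borelize (GL (Fin m) F)
    exact rank_whittakerFunctionals_le_one_of_isSupercuspidal_of_gelfandKazhdan ρ ψ h2 h3 hψ
      (hA m hm2 hm ψ (Or.inl rfl)) (hA m hm2 hm ψ⁻¹ (Or.inr rfl))

end Reduction

end Literature.NumberTheory.Automorphic
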